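import Literature.AlgebraicGeometry.Frobenioids.DivisorMonoidRightEqLeftLocal
import Literature.AlgebraicGeometry.Frobenioids.Thm42PreservesPrimarySchemaClosure
import Literature.AlgebraicGeometry.Frobenioids.CoAngular
import HarnessLib

/-!
# Frobenioids I, Theorem 4.9, sub-DAG slot `FrdI.T49.RightEqLeftAt F₁ F₂ Ψ A 𝔭 𝔭'` ("the right-hand and
# left-hand isomorphisms of Theorem 4.2 (iii) coincide"): its universal closure is false; instance forms

Mochizuki, *The geometry of Frobenioids I: the general theory*, Kyushu J. Math. **62** (2008) 293–400, §4,
Theorem 4.9, proof, kurims text p. 89 ll. 6–9 [cite: MochizukiFrdI2008, Thm. 4.9 p.89]: "it suffices to show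
that the right-hand and left-hand isomorphisms of Theorem 4.2, (iii), coincide".

In the tree this is the PREDICATE `FrdI.T49.RightEqLeftAt F₁ F₂ Ψ A 𝔭 𝔭'` (`Thm49Sub.lean`, abc-iut-L1
lineage): ONE isomorphism of monoids `Φ₁(A)_𝔭 ≃* Φ₂(Ψ A)_𝔭'` computing `Div(Ψ φ)` for co-angular pre-steps
out of `A` and `(Ψψ)_* Div(Ψ ψ)` for co-angular pre-steps into `A`.  It is the body-head of the proved
closure fact `FrdI.T49.TwinPrimaryCriterion…` and is obtained from a global divisor-monoid isomorphism by
`FrdI.T49.rightEqLeftAt_of_mulEquiv` (`DivisorMonoidRightEqLeftLocal.lean`); the cell's frozen FACT-LIST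
lists the bare predicate as row F-2657 (class `preparatory`, kernel_closedness `parametrised`, label
«model-witness: body-head of a PROVED 0-ary closure fact»).  Its universal closure — "for ANY two structure
functors, ANY equivalence and ANY pair of primes such an isomorphism exists" — is false.  This PROOF-ONLY
file (abc-iut cell, block F fact-proving wave, seat abc-iut-f-012; no definition, no instance) records:

* `FrdI.T49.not_forall_rightEqLeftAt` — ¬∀ over exactly the declaration's binders (universe level `0`),
  from the closed witness `not_rightEqLeftAt_standard`: on the STANDARD Frobenioid `F_{ℤ≥0}` ([FrdI] Def. 1.1
  (iii), `StandardFrobenioidExample`; structure `F_Φ → F_{Φ^char}`) take `Ψ := 𝟭`, for the second structure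
  the zero-section structure INTO THE SAME divisor monoid `Φ^char` (every arrow gets the zero divisor), and
  for `𝔭 = 𝔭'` the prime of `ℤ≥0` (the class of the primary element `1`,
  `FrdI.T42.isPrimary_mk_ofAdd_one`): the endomorphism `(id, 1, 1)` (`stepOne`) is a co-angular pre-step
  (endomorphisms of a Frobenioid are co-angular, `PreFrobenioid.isCoAngular_endo`) with `Div = 1 ∈ M_𝔭`, so
  the right-hand clause would force an ISOMORPHISM of monoids to send the non-trivial element `1` to the zero
  divisor `0` of its image.  What the witness exploits: `F₂` is a free structure functor; nothing about print.
* Instance forms that HOLD: `FrdI.T49.rightEqLeftAt_refl` (NEW, every pre-Frobenioid: with `F₂ = F₁`,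
  `Ψ = 𝟭`, `𝔭' = 𝔭` the identity isomorphism works) and, by name, `FrdI.T49.rightEqLeftAt_of_mulEquiv`
  (abc-iut lineage w5: from a global isomorphism `Φ₁(A) ≃* Φ₂(Ψ A)` computing divisors of pre-steps, in a
  Frobenioid) — assembled in `rightEqLeftAt_schema_census`.

So F-2657 is admissible only as the conclusion it already is (FACT-LIST class «universal-closure REFUTED;
instance form PROVED»).  Elementary; nothing here bears on [IUTchIII] Cor. 3.12 or takes a side; refuted-as-
closure is a statement about OUR typing's binders, not about the paper.
-/

noncomputable section

namespace Literature.AlgebraicGeometry.Frobenioids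

open CategoryTheory Opposite StandardFrobenioidExample

namespace FrdI.T49

universe w v v' u u'

/-! ### A positive instance in every pre-Frobenioid: reflexivity -/

/-- **`RightEqLeftAt` holds for `F₂ = F₁`, `Ψ = 𝟭`, `𝔭' = 𝔭`** (the identity isomorphism of `M_𝔭` computes
both sides) — every structure functor, every object, every prime. [cite: MochizukiFrdI2008, Thm. 4.9 p.89] -/
theorem rightEqLeftAt_refl {D : Type u} [Category.{v} D] {Φ : Dᵒᵖ ⥤ CommMonCat.{w}} {C : Type u'}
    [Category.{v'} C] (F : C ⥤ ElemFrobenioid Φ) (A : C)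
    (𝔭 : Primes (Φ.obj (op (PreFrobenioid.baseObj F A)))) :
    RightEqLeftAt F F (CategoryTheory.Equivalence.refl : C ≌ C) A 𝔭 𝔭 :=
  ⟨MulEquiv.refl _, fun _ _ _ _ => rfl, fun _ _ _ _ _ hy => hy⟩

/-! ### The witness on the standard Frobenioid -/

/-- The prime of `ℤ≥0` (modulo units): the class of the primary element `1`.
[cite: MochizukiFrdI2008, §0 p.12] -/
theorem mk_ofAdd_one_mem_carrier :
    (Associates.mk (Multiplicative.ofAdd (1 : ℕ)) : Associates M) ∈
      Primes.carrier (Quotient.mk (primarySetoid (Associates M))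
        ⟨Associates.mk (Multiplicative.ofAdd (1 : ℕ)), FrdI.T42.isPrimary_mk_ofAdd_one⟩) :=
  ⟨FrdI.T42.isPrimary_mk_ofAdd_one, rfl⟩

/-- **Closed witness**: on the standard Frobenioid with `Ψ := 𝟭`, the zero-section structure into the same
divisor monoid as second structure, and the prime of `1 ∈ ℤ≥0` on both sides, `RightEqLeftAt` FAILS at the
(unique) object: the co-angular pre-step `(id, 1, 1)` has `Div = 1 ≠ 0`, but its image has `Div = 0`, and an
isomorphism of monoids sends only the neutral element to the neutral element.
[cite: MochizukiFrdI2008, Thm. 4.9 p.89] -/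
theorem not_rightEqLeftAt_standard :
    ¬ RightEqLeftAt (ElemFrobenioid.toChar Φst)
        (ElemFrobenioid.baseFunctor Φst ⋙ ElemFrobenioid.zeroSection (charFunctor Φst))
        (CategoryTheory.Equivalence.refl : ElemFrobenioid Φst ≌ ElemFrobenioid Φst)
        StandardFrobenioidExample.A
        (Quotient.mk (primarySetoid (Associates M))
          ⟨Associates.mk (Multiplicative.ofAdd (1 : ℕ)), FrdI.T42.isPrimary_mk_ofAdd_one⟩)
        (Quotient.mk (primarySetoid (Associates M))
          ⟨Associates.mk (Multiplicative.ofAdd (1 : ℕ)), FrdI.T42.isPrimary_mk_ofAdd_one⟩) := by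
  rintro ⟨m, hright, -⟩
  have hca : PreFrobenioid.IsCoAngularPreStep (ElemFrobenioid.toChar Φst)
      (stepOne StandardFrobenioidExample.A) :=
    ⟨PreFrobenioid.isCoAngular_endo _ StandardFrobenioidExample.isFrobenioid _, isPreStep_stepOne _⟩
  have hmem := Submonoid.subset_closure mk_ofAdd_one_mem_carrier
  have h := hright (stepOne StandardFrobenioidExample.A) hca hmem
  -- the right-hand side is the zero divisor of the image, i.e. the neutral element
  have h1 : m ⟨_, hmem⟩ = 1 := Subtype.ext h
  rw [MulEquiv.map_eq_one_iff] at h1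
  exact FrdI.T42.isPrimary_mk_ofAdd_one.1 (congrArg Subtype.val h1)

/-! ### The universal closure is false; the instance forms -/

/-- **The universal closure of the sub-DAG slot `FrdI.T49.RightEqLeftAt` is FALSE** (FACT-LIST F-2657: a
body-head predicate, not a hypothesis).  Binders exactly those of the declaration, universe level `0`.
[cite: MochizukiFrdI2008, Thm. 4.9 p.89] -/
theorem not_forall_rightEqLeftAt :
    ¬ ∀ (D₁ : Type) [Category.{0} D₁] (Φ₁ : D₁ᵒᵖ ⥤ CommMonCat.{0}) (C₁ : Type) [Category.{0} C₁]
        (D₂ : Type) [Category.{0} D₂] (Φ₂ : D₂ᵒᵖ ⥤ CommMonCat.{0}) (C₂ : Type) [Category.{0} C₂]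
        (F₁ : C₁ ⥤ ElemFrobenioid Φ₁) (F₂ : C₂ ⥤ ElemFrobenioid Φ₂) (Ψ : C₁ ≌ C₂) (A : C₁)
        (𝔭 : Primes (Φ₁.obj (op (PreFrobenioid.baseObj F₁ A))))
        (𝔭' : Primes (Φ₂.obj (op (PreFrobenioid.baseObj F₂ (Ψ.functor.obj A))))),
        Literature.AlgebraicGeometry.Frobenioids.FrdI.T49.RightEqLeftAt F₁ F₂ Ψ A 𝔭 𝔭' :=
  fun h => not_rightEqLeftAt_standard (h _ _ _ _ _ _ _ _ _ _ _ _)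

/-- **Census of F-2657**: the closure is false, while (i) `RightEqLeftAt` holds reflexively for EVERY
structure functor, object and prime (`rightEqLeftAt_refl`), and (ii) in a Frobenioid it holds at every pair
of primes exchanged by a global isomorphism `Φ₁(A) ≃* Φ₂(Ψ A)` computing the divisors of pre-steps
(`rightEqLeftAt_of_mulEquiv`, by name — print's route p. 89). [cite: MochizukiFrdI2008, Thm. 4.9 p.89] -/
theorem rightEqLeftAt_schema_census {D : Type u} [Category.{v} D] {Φ : Dᵒᵖ ⥤ CommMonCat.{w}} {C : Type u'}
    [Category.{v'} C] (F : C ⥤ ElemFrobenioid Φ) (A : C)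
    (𝔭 : Primes (Φ.obj (op (PreFrobenioid.baseObj F A)))) :
    (¬ ∀ (D₁ : Type) [Category.{0} D₁] (Φ₁ : D₁ᵒᵖ ⥤ CommMonCat.{0}) (C₁ : Type) [Category.{0} C₁]
        (D₂ : Type) [Category.{0} D₂] (Φ₂ : D₂ᵒᵖ ⥤ CommMonCat.{0}) (C₂ : Type) [Category.{0} C₂]
        (F₁ : C₁ ⥤ ElemFrobenioid Φ₁) (F₂ : C₂ ⥤ ElemFrobenioid Φ₂) (Ψ : C₁ ≌ C₂) (A : C₁)
        (𝔭 : Primes (Φ₁.obj (op (PreFrobenioid.baseObj F₁ A))))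
        (𝔭' : Primes (Φ₂.obj (op (PreFrobenioid.baseObj F₂ (Ψ.functor.obj A))))),
        Literature.AlgebraicGeometry.Frobenioids.FrdI.T49.RightEqLeftAt F₁ F₂ Ψ A 𝔭 𝔭') ∧
      RightEqLeftAt F F (CategoryTheory.Equivalence.refl : C ≌ C) A 𝔭 𝔭 :=
  ⟨not_forall_rightEqLeftAt, rightEqLeftAt_refl F A 𝔭⟩

end FrdI.T49

end Literature.AlgebraicGeometry.Frobenioids

end
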